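/- LEAD seat `ym-line-cbag-p1` (prover-ym-line-cbag-p1-g28-0; own crux stmt-QuantumFields-22254 `BoxFloorAllGroups` CLOSED·proved),
LINE 7 `GlueballBandRecursion`, item ⟨stmt-QuantumFields-22957⟩ `OneParticleBlochSymbolFamily` (= `Band.EffectiveBlochSymbolFamily`):
part 1/2 of the planner's stub S2 `blochSymbolOfCovariantFamily` (STUB-PLAN-22957, 2026-08-28T18:17Z) in abstract, typing-independent
form — block-circulant matrices and their Bloch matrices.  Route-independent (no `Theses` import); `--supports` the item as a helper. -/
import Literature.MathematicalPhysics.QuantumFieldTheory.Balaban1983to89.B5Prop11Plancherel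

/-!
# Route `GlueballBandRecursion`, item `OneParticleBlochSymbolFamily` (stmt-QuantumFields-22957): block-circulant matrices on a
# finite torus are block-diagonalised by the block DFT; `tr C^t = Σ_p tr B(p)^t` (stub S2, part 1: the matrix algebra)

The item (`Band.EffectiveBlochSymbolFamily`) asks for Hermitian momentum blocks `B̃(θ_p)`, `p ∈ (Fin N)³`, carrying the cold thermal
trace of the strong-coupling transfer matrix.  Stub S2 of the planner's plan (evidence `STUB-PLAN-22957-OneParticleBlochSymbolFamily.md`):
a translation-covariant frame of the one-particle band yields Hermitian `n × n` Bloch matrices whose eigenvalues are the band levels.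
THIS FILE is the pure matrix algebra behind it, over `ℂ`, on any finite torus `T = Π_μ ℤ/N_μ` (reusing the tree's characters `chi`,
their orthogonality `sum_chi` and the unitary `dft` of `Balaban1983to89.B5Prop11Plancherel`):

* §1 for ANY matrix kernel `h : T → Mat_n(ℂ)`: the block-circulant matrix `C[(x,i),(y,j)] = h(y − x)_{ij}` (`blockCirculant`), the
  **Bloch matrices** `B(p) = Σ_x e^{ip·x} h(x)` (`blochMatrix`), the block DFT `F = dft ⊗ 1_n` (`dftBlock`, unitary), and
  **`F C F^* = ⊕_p B(p)`** (`dftBlock_conj_blockCirculant`; [BFKT16] Lemma 1 "periodic operators are block diagonal in momentum"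
  in its finite-dimensional form);
* §2 the algebra of momentum-block-diagonal matrices (`momBlock_mul`, `momBlock_pow`, `trace_momBlock`) and the **trace identity**
  `tr C^t = Σ_p tr B(p)^t` for every `t` (`trace_pow_blockCirculant`);
* §3 reflection-Hermitian kernels `h(−x) = h(x)ᴴ` (the kernel `⟪ψ_{x,·}, Tψ_{y,·}⟫` of a self-adjoint `T`) give Hermitian `B(p)`
  (`blochMatrix_isHermitian`; real symmetric version `map_ofReal_reflect`).

Part 2 (`GlueballBandRecursionBlochReduction.lean`) adds the Hilbert-space bridge `Σ_k μ_k^t = tr C^t` and the transfer-matrix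
corollaries (lower half of (P4) for the Bloch blocks of any covariant excited frame).  Deliberately NOT here: anything spectral or
analytic (stubs S1, S3, S4 of the plan).

HONEST FRAMING.  Finite-dimensional linear algebra ([folklore]); nothing about the item, the rung `ColdDoublingRecursionStrongCoupling`
or the Yang–Mills mass gap / the summit `YangMills` is proved or advanced here.

References: Bałaban–Feldman–Knörrer–Trubowitz, *Bloch theory for periodic block spin transformations*, arXiv:1609.00964, Lemma 1;
Montvay–Münster (1994) §3.2.6; Reed–Simon IV §XIII.16.
-/

set_option autoImplicit false

noncomputable section

open scoped BigOperators ComplexConjugate Matrix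
open Finset
open Literature.MathematicalPhysics.QuantumFieldTheory.Balaban1983to89.B5Prop11Plancherel
  (Tor chi dft conj_chi chi_add_left chi_add_right sum_chi dft_mul_star chi_neg_neg)

namespace Summit.QuantumFields.YangMills.Theorems.GlueballBandRecursion.Band

namespace Bloch

/-! ### §1 Block-circulant matrices, Bloch matrices and the block DFT on a finite torus `Π_μ ℤ/N_μ` -/

section MatrixPart

variable {d : ℕ} (N : Fin d → ℕ) (n : ℕ)

/-- The **block-circulant matrix** of a matrix-valued kernel `h : T → Mat_n(ℂ)` on the finite torus `T = Π_μ ℤ/N_μ`: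
`C[(x,i),(y,j)] = h(y − x)_{ij}` (the matrix, in a translation-covariant frame `ψ_{x,i} = U_x ψ_{0,i}`, of an operator
commuting with the translations). [folklore] -/
def blockCirculant (h : Tor N → Matrix (Fin n) (Fin n) ℂ) : Matrix (Tor N × Fin n) (Tor N × Fin n) ℂ :=
  Matrix.of fun a b => h (b.1 - a.1) a.2 b.2

/-- The matrix that is **block-diagonal in momentum** with blocks `B(p)`: `D[(p,i),(q,j)] = δ_{pq} B(p)_{ij}`. [folklore] -/
def momBlock (B : Tor N → Matrix (Fin n) (Fin n) ℂ) : Matrix (Tor N × Fin n) (Tor N × Fin n) ℂ :=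
  Matrix.of fun a b => if a.1 = b.1 then B a.1 a.2 b.2 else 0

variable {N n}

/-- Entries of the block-circulant matrix. -/
@[simp] theorem blockCirculant_apply (h : Tor N → Matrix (Fin n) (Fin n) ℂ) (x : Tor N) (i : Fin n) (y : Tor N)
    (j : Fin n) : blockCirculant N n h (x, i) (y, j) = h (y - x) i j := rfl

/-- Entries of the momentum-block-diagonal matrix. -/
@[simp] theorem momBlock_apply (B : Tor N → Matrix (Fin n) (Fin n) ℂ) (p : Tor N) (i : Fin n) (q : Tor N) (j : Fin n) :
    momBlock N n B (p, i) (q, j) = if p = q then B p i j else 0 := rfl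

variable (N n) [∀ μ, NeZero (N μ)]

/-- The **Bloch matrix** (momentum block) of the kernel `h` at the torus momentum `p`: `B(p) = Σ_x e^{ip·x} h(x)`
(`e^{ip·x} = chi N p x = Π_μ exp(2πi p_μ x_μ/N_μ)`). [folklore] -/
def blochMatrix (h : Tor N → Matrix (Fin n) (Fin n) ℂ) (p : Tor N) : Matrix (Fin n) (Fin n) ℂ :=
  ∑ x, chi N p x • h x

/-- The **block discrete Fourier transform** `F[(p,i),(x,i')] = δ_{ii'}·|T|^{-1/2} e^{-ip·x}` (the tree's unitary `dft` of
`B5Prop11Plancherel` on each of the `n` components). [folklore] -/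
def dftBlock : Matrix (Tor N × Fin n) (Tor N × Fin n) ℂ :=
  Matrix.blockDiagonal fun _ : Fin n => dft N

variable {N n}


/-- Entries of the Bloch matrix: `B(p)_{ij} = Σ_x e^{ip·x} h(x)_{ij}`. -/
theorem blochMatrix_apply (h : Tor N → Matrix (Fin n) (Fin n) ℂ) (p : Tor N) (i j : Fin n) :
    blochMatrix N n h p i j = ∑ x, chi N p x * h x i j := by
  simp only [blochMatrix, Matrix.sum_apply, Matrix.smul_apply, smul_eq_mul]

/-- Entries of the block DFT. -/
theorem dftBlock_apply (p : Tor N) (i : Fin n) (x : Tor N) (i' : Fin n) :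
    dftBlock N n (p, i) (x, i') = if i = i' then dft N p x else 0 := by
  simp only [dftBlock, Matrix.blockDiagonal_apply]

variable (N n)

/-- The block DFT is unitary. [folklore] -/
theorem dftBlock_mem_unitaryGroup : dftBlock N n ∈ Matrix.unitaryGroup (Tor N × Fin n) ℂ := by
  rw [Matrix.mem_unitaryGroup_iff, dftBlock, Matrix.star_eq_conjTranspose, Matrix.blockDiagonal_conjTranspose,
    ← Matrix.blockDiagonal_mul]
  have h : (fun _ : Fin n => dft N * (dft N)ᴴ) = fun _ => 1 := by
    funext k
    rw [← Matrix.star_eq_conjTranspose, dft_mul_star]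
  rw [h]
  exact Matrix.blockDiagonal_one

/-- `F F^* = 1`. [folklore] -/
theorem dftBlock_mul_star : dftBlock N n * star (dftBlock N n) = 1 :=
  Matrix.mem_unitaryGroup_iff.mp (dftBlock_mem_unitaryGroup N n)

/-- `F^* F = 1`. [folklore] -/
theorem star_dftBlock_mul : star (dftBlock N n) * dftBlock N n = 1 :=
  Matrix.mem_unitaryGroup_iff'.mp (dftBlock_mem_unitaryGroup N n)

variable {N n}

/-- Left multiplication by the block DFT: `(F M)[(p,i), b] = Σ_x F_{px} M[(x,i), b]`. -/
theorem dftBlock_mul_apply (M : Matrix (Tor N × Fin n) (Tor N × Fin n) ℂ) (p : Tor N) (i : Fin n) (b : Tor N × Fin n) :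
    (dftBlock N n * M) (p, i) b = ∑ x, dft N p x * M (x, i) b := by
  rw [Matrix.mul_apply, Fintype.sum_prod_type]
  refine Finset.sum_congr rfl fun x _ => ?_
  simp only [dftBlock_apply, ite_mul, zero_mul, Finset.sum_ite_eq, Finset.mem_univ, if_true]

/-- Right multiplication by the adjoint block DFT: `(M F^*)[a, (q,j)] = Σ_y M[a, (y,j)] conj F_{qy}`. -/
theorem mul_star_dftBlock_apply (M : Matrix (Tor N × Fin n) (Tor N × Fin n) ℂ) (a : Tor N × Fin n) (q : Tor N) (j : Fin n) :
    (M * star (dftBlock N n)) a (q, j) = ∑ y, M a (y, j) * conj (dft N q y) := by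
  rw [Matrix.mul_apply, Fintype.sum_prod_type]
  refine Finset.sum_congr rfl fun y _ => ?_
  have h : ∀ j' : Fin n, star (dftBlock N n) (y, j') (q, j) = if j = j' then conj (dft N q y) else 0 := by
    intro j'
    rw [Matrix.star_apply, dftBlock_apply]
    split_ifs <;> simp
  simp only [h, mul_ite, mul_zero, Finset.sum_ite_eq, Finset.mem_univ, if_true]

/-- `conj e^{ip·x} · e^{iq·x} = e^{i(q−p)·x}`. -/
theorem conj_chi_mul_chi' (p q x : Tor N) : conj (chi N p x) * chi N q x = chi N (q - p) x := by
  rw [conj_chi, ← chi_add_left, neg_add_eq_sub]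

/-- **The block DFT block-diagonalises every block-circulant matrix**: `F C F^* = ⊕_p B(p)`, the Bloch matrices as the
momentum blocks. [folklore] -/
theorem dftBlock_conj_blockCirculant (h : Tor N → Matrix (Fin n) (Fin n) ℂ) :
    dftBlock N n * blockCirculant N n h * star (dftBlock N n) = momBlock N n (blochMatrix N n h) := by
  classical
  ext ⟨p, i⟩ ⟨q, j⟩
  rw [mul_star_dftBlock_apply, momBlock_apply]
  simp_rw [dftBlock_mul_apply, blockCirculant_apply]
  -- the normalising constant
  set c : ℝ := (Real.sqrt (Fintype.card (Tor N)))⁻¹ with hc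
  have hcard : (0 : ℝ) < Fintype.card (Tor N) := by exact_mod_cast Fintype.card_pos
  have hcc : (c : ℂ) * c * (Fintype.card (Tor N) : ℂ) = 1 := by
    rw [← Complex.ofReal_mul, hc, ← mul_inv, Real.mul_self_sqrt hcard.le, ← Complex.ofReal_natCast,
      ← Complex.ofReal_mul, inv_mul_cancel₀ hcard.ne', Complex.ofReal_one]
  have hdft : ∀ r y : Tor N, dft N r y = (c : ℂ) * conj (chi N r y) := fun r y => rfl
  -- expand and reindex `y = x + z`
  have hterm : ∀ y x : Tor N, dft N p x * h (y - x) i j * conj (dft N q y) =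
      (c : ℂ) * c * (conj (chi N p x) * chi N q y * h (y - x) i j) := by
    intro y x
    rw [hdft, hdft, map_mul, Complex.conj_ofReal, Complex.conj_conj]
    ring
  simp_rw [Finset.sum_mul, hterm, ← Finset.mul_sum]
  rw [Finset.sum_comm]
  have hre : ∀ x : Tor N, ∑ y, conj (chi N p x) * chi N q y * h (y - x) i j =
      conj (chi N p x) * chi N q x * ∑ z, chi N q z * h z i j := by
    intro x
    rw [← Fintype.sum_equiv (Equiv.addLeft x) (fun z => conj (chi N p x) * chi N q (x + z) * h (x + z - x) i j)
      (fun y => conj (chi N p x) * chi N q y * h (y - x) i j) (fun z => rfl), Finset.mul_sum]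
    refine Finset.sum_congr rfl fun z _ => ?_
    simp only [add_sub_cancel_left, chi_add_right]
    ring
  simp_rw [hre, ← Finset.sum_mul, conj_chi_mul_chi', sum_chi]
  by_cases hpq : p = q
  · subst hpq
    rw [if_pos (sub_self p), if_pos rfl, blochMatrix_apply, ← mul_assoc, hcc, one_mul]
  · rw [if_neg (fun h0 => hpq (sub_eq_zero.mp h0).symm), if_neg hpq, zero_mul, mul_zero]

/-! ### §2 Algebra of momentum-block-diagonal matrices and the trace identity -/

/-- Products of momentum-block-diagonal matrices are computed blockwise. [folklore] -/
theorem momBlock_mul (B B' : Tor N → Matrix (Fin n) (Fin n) ℂ) :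
    momBlock N n B * momBlock N n B' = momBlock N n (fun p => B p * B' p) := by
  classical
  ext ⟨p, i⟩ ⟨q, j⟩
  rw [Matrix.mul_apply, Fintype.sum_prod_type, momBlock_apply]
  have h : ∀ r : Tor N, ∑ k : Fin n, momBlock N n B (p, i) (r, k) * momBlock N n B' (r, k) (q, j) =
      if p = r then (if r = q then ∑ k, B p i k * B' r k j else 0) else 0 := by
    intro r
    split_ifs with h1 h2
    · subst h1
      subst h2
      simp only [momBlock_apply, if_true]
    · subst h1
      simp only [momBlock_apply, if_true, if_neg h2, mul_zero, Finset.sum_const_zero]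
    · simp only [momBlock_apply, if_neg h1, zero_mul, Finset.sum_const_zero]
  simp_rw [h]
  rw [Finset.sum_ite_eq, if_pos (Finset.mem_univ p)]
  split_ifs with hpq
  · subst hpq
    rw [Matrix.mul_apply]
  · rfl

/-- Powers of a momentum-block-diagonal matrix are computed blockwise. [folklore] -/
theorem momBlock_pow (B : Tor N → Matrix (Fin n) (Fin n) ℂ) (t : ℕ) :
    momBlock N n B ^ t = momBlock N n (fun p => B p ^ t) := by
  classical
  induction t with
  | zero =>
    ext ⟨p, i⟩ ⟨q, j⟩
    rw [pow_zero, momBlock_apply, Matrix.one_apply]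
    by_cases hpq : p = q
    · subst hpq
      simp only [if_true, pow_zero, Matrix.one_apply, Prod.mk.injEq, true_and]
    · rw [if_neg hpq, if_neg (fun h => hpq (Prod.mk.inj h).1)]
  | succ t ih =>
    rw [pow_succ, ih, momBlock_mul]
    simp only [← pow_succ]

/-- The trace of a momentum-block-diagonal matrix is the sum of the block traces. [folklore] -/
theorem trace_momBlock (B : Tor N → Matrix (Fin n) (Fin n) ℂ) :
    (momBlock N n B).trace = ∑ p, (B p).trace := by
  simp only [Matrix.trace, Matrix.diag, Fintype.sum_prod_type, momBlock_apply, if_true]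

/-- **Trace identity (Bloch reduction of traces)**: for every matrix kernel `h` on the torus and every `t`,
`tr C^t = Σ_p tr B(p)^t` — the trace of a power of the block-circulant matrix is the sum over momenta of the traces of the
powers of its Bloch matrices. [folklore] -/
theorem trace_pow_blockCirculant (h : Tor N → Matrix (Fin n) (Fin n) ℂ) (t : ℕ) :
    (blockCirculant N n h ^ t).trace = ∑ p, (blochMatrix N n h p ^ t).trace := by
  set F := dftBlock N n with hF
  set D := momBlock N n (blochMatrix N n h) with hD
  have h1 : F * star F = 1 := dftBlock_mul_star N n
  have h2 : star F * F = 1 := star_dftBlock_mul N n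
  have hconj : F * blockCirculant N n h * star F = D := dftBlock_conj_blockCirculant h
  have hC : blockCirculant N n h = star F * D * F := by
    rw [← hconj]
    calc blockCirculant N n h = (star F * F) * blockCirculant N n h * (star F * F) := by rw [h2, one_mul, mul_one]
      _ = star F * (F * blockCirculant N n h * star F) * F := by simp only [Matrix.mul_assoc]
  have hpow : ∀ s : ℕ, blockCirculant N n h ^ s = star F * D ^ s * F := by
    intro s
    induction s with
    | zero => rw [pow_zero, pow_zero, mul_one, h2]
    | succ s ih =>
      rw [pow_succ, ih, hC]
      calc star F * D ^ s * F * (star F * D * F) = star F * D ^ s * (F * star F) * D * F := by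
            simp only [Matrix.mul_assoc]
        _ = star F * D ^ (s + 1) * F := by rw [h1, mul_one, pow_succ, Matrix.mul_assoc (star F)]
  rw [hpow, Matrix.trace_mul_cycle, h1, one_mul, hD, momBlock_pow, trace_momBlock]

/-! ### §3 Hermitian kernels give Hermitian Bloch matrices -/

/-- If the kernel is Hermitian under reflection, `h(−x) = h(x)ᴴ` (the kernel `⟪ψ_{x,i}, T ψ_{y,j}⟫` of a self-adjoint `T`),
then every Bloch matrix `B(p)` is Hermitian. [folklore] -/
theorem blochMatrix_isHermitian {h : Tor N → Matrix (Fin n) (Fin n) ℂ} (hh : ∀ x, h (-x) = (h x)ᴴ) (p : Tor N) :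
    (blochMatrix N n h p).IsHermitian := by
  unfold Matrix.IsHermitian blochMatrix
  rw [Matrix.conjTranspose_sum]
  rw [← Fintype.sum_equiv (Equiv.neg (Tor N)) (fun x => (chi N p (-x) • h (-x))ᴴ) (fun x => (chi N p x • h x)ᴴ)
    (fun x => rfl)]
  refine Finset.sum_congr rfl fun x _ => ?_
  rw [Matrix.conjTranspose_smul, hh, Matrix.conjTranspose_conjTranspose, Complex.star_def, conj_chi, chi_neg_neg]

omit [∀ μ, NeZero (N μ)] in
/-- For a REAL kernel `hr` with `hr(−x) = hr(x)ᵀ` (the kernel of a symmetric operator on a real Hilbert space) the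
complexified kernel is Hermitian under reflection. -/
theorem map_ofReal_reflect {hr : Tor N → Matrix (Fin n) (Fin n) ℝ} (hh : ∀ x, hr (-x) = (hr x)ᵀ) (x : Tor N) :
    (hr (-x)).map (Complex.ofReal) = ((hr x).map Complex.ofReal)ᴴ := by
  rw [hh, Matrix.conjTranspose, Matrix.transpose_map]
  ext i j
  simp only [Matrix.map_apply, Matrix.transpose_apply, Complex.star_def, Complex.conj_ofReal]

end MatrixPart

end Bloch

end Summit.QuantumFields.YangMills.Theorems.GlueballBandRecursion.Band

end
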